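import Literature.Probability.LatticeModels.TorusNegTypeBochner
import Literature.Analysis.Matrix.SchoenbergKernelsProofs
import HarnessLib

/-!
# Lévy–Khintchine on the finite torus `(ℤ/Lℤ)^d` and the Lévy bootstrap lemma

Discrete Lévy–Khintchine calculus for a positive, even, infinitely divisible function on the finite
torus, in the vocabulary of `TorusFourierProofs` / `TorusNegTypeBochner` (characters `torusChar`,
cosine coefficients `A(q) = ∑_x f(x) Re χ_q(x)`). Nothing is defined; every statement is written with
the explicit sums.

For an EVEN real function `f` on `(ℤ/Lℤ)^d` (think `f = log k` for a positive even kernel `k`):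

* `torus_real_inversion_of_even` — cosine Fourier inversion `L^d f(z) = ∑_q A(q) Re χ_q(z)`;
* `levyKhintchine_pointwise` — `L^d (f(0) - f(z)) = ∑_q A(q) (1 - Re χ_q(z))` (the finite-group
  Lévy–Khintchine formula: with `φ = f(0) - f` and `ν_q = A(q)/L^d`, `φ(z) = ∑_{q ≠ 0} ν_q (1 - Re χ_q z)`);
* `levyKhintchine_mean` — the LÉVY MASS identity `∑_z (f(0) - f(z)) = ∑_{q ≠ 0} A(q)`
  ("Lévy mass = mean of `φ`", i.e. `|ν| := ∑_{q≠0} ν_q = L^{-d} ∑_z φ(z)`).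

For a POSITIVE even `k` whose logarithm has nonnegative coefficients `A(q) ≥ 0` at `q ≠ 0`
(infinite divisibility of the translation-invariant kernel `k(x - y)`, cf.
`isNegDefKernel_neg_sub_iff_torusFourier_re_nonneg` and Schoenberg's theorem):

* `levy_wing_bound` — the GOLDSTONE-WING bound `A(q) ≤ e^{|ν|} k̂(q) / k(0)` for `q ≠ 0`,
  `k̂(q) = ∑_x k(x) Re χ_q(x)`: the normalised function `r = log k - log k(0) + |ν|` has ALL cosine
  coefficients nonnegative (the zero mode vanishes by the Lévy-mass identity), so `r(x - y)` is a
  positive definite kernel, hence so is `exp r - 1 - r` (Schur products, BCR 3.1.12/1.14), and the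
  `q`-th coefficient of `exp r = e^{|ν|} k / k(0)` dominates that of `r`;
* `levy_uv_bound` — the UV-MASS bound `c · ∑_{q ∈ S} A(q) ≤ L^d ∑_{z ∈ D} (f(0) - f(z))` whenever
  `∑_{z ∈ D} (1 - Re χ_q(z)) ≥ c` on `S ⊆ {q ≠ 0}`;
* `levyMass_le_logBootstrap` — the LÉVY BOOTSTRAP LEMMA (shape of the log-bootstrap of route
  `HubbardSuperconductivity/LevyLogBootstrap`, crux `LevyTransport`, foreseen layer P1):
  `|ν| ≤ U + β e^{|ν|}` with `U = (∑_{z∈D} φ(z))/c` (local log-decoherence) and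
  `β = ∑_{q ∉ S, q ≠ 0} k̂(q) / (L^d k(0))` (the infrared wing).

Also two generic kernel facts: `isPosDefKernel_of_sum_nonneg` (finite-type test),
`IsPosDefKernel.exp_sub_one_sub` (`exp φ - 1 - φ` is positive definite with `φ`), and Bochner's
theorem on the finite torus in positive-type form (⇐) `isPosDefKernel_sub_of_torusFourier_re_nonneg`.

Sources: C. Berg, J. P. R. Christensen, P. Ressel, *Harmonic Analysis on Semigroups* (1984), Ch. 3
§1 (Schur products, 1.12–1.14), §2 (Schoenberg), Ch. 4 §3 (negative definite functions on abelian
groups and their Lévy–Khintchine representation); W. Rudin, *Fourier Analysis on Groups* (1962)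
§1.4.3 (Bochner); G. Slade, *The Lace Expansion and its Applications*, LNM 1879 (2006), Lemma 5.9 (the
bootstrap SHAPE). All statements are finite-dimensional and sorry-free.
-/

noncomputable section

open Finset Complex Filter
open scoped ComplexConjugate BigOperators Topology

namespace Literature.Probability.LatticeModels

open Literature.Analysis.Matrix

/-! ### Two generic facts on positive definite kernels -/

section PosDef

variable {X : Type*}

/-- A positive definite kernel `φ` gives a negative definite kernel `-φ` (the quadratic form of `-φ`
is `≤ 0` on all coefficient vectors, in particular on those with zero sum). BCR Ch. 3 §1.
[cite: BergChristensenRessel1984, Ch. 3 Def. 1.1 (PDF p. 68)] -/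
theorem _root_.Literature.Analysis.Matrix.IsPosDefKernel.isNegDefKernel_neg {φ : X → X → ℝ}
    (h : IsPosDefKernel φ) : IsNegDefKernel fun x y => -φ x y := by
  refine ⟨fun x y => by simp only [h.1 x y], fun n x c _ => ?_⟩
  have e : ∑ j, ∑ k, c j * c k * -φ (x j) (x k) = -∑ j, ∑ k, c j * c k * φ (x j) (x k) := by
    simp only [mul_neg, Finset.sum_neg_distrib]
  rw [e, neg_nonpos]
  exact h.2 n x c

/-- **`exp φ - 1 - φ` is positive definite with `φ`** (BCR 3.1.12–1.14: the partial sums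
`∑_{2 ≤ k < N} φ^k / k!` are positive definite by Schur's product theorem and converge pointwise).
This is the quantitative form of "the exponential of a positive definite kernel is positive
definite" used for the Goldstone-wing bound. [cite: BergChristensenRessel1984, Ch. 3 Cor. 1.14 (PDF p. 71)] -/
theorem _root_.Literature.Analysis.Matrix.IsPosDefKernel.exp_sub_one_sub {φ : X → X → ℝ}
    (h : IsPosDefKernel φ) : IsPosDefKernel fun x y => Real.exp (φ x y) - 1 - φ x y := by
  refine isPosDefKernel_of_tendsto (l := (atTop : Filter ℕ))
    (φs := fun N x y => ∑ k ∈ Finset.range N, (((k + 2).factorial : ℝ)⁻¹) * φ x y ^ (k + 2))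
    (Eventually.of_forall fun N =>
      isPosDefKernel_finsetSum _ fun k _ => (h.pow (k + 2)).const_mul (by positivity))
    fun x y => ?_
  have hs : HasSum (fun k => ((k.factorial : ℝ)⁻¹) • φ x y ^ k) (Real.exp (φ x y)) := by
    rw [Real.exp_eq_exp_ℝ]
    exact NormedSpace.exp_series_hasSum_exp' (𝕂 := ℝ) (φ x y)
  have hs2 : HasSum (fun k : ℕ => (((k + 2).factorial : ℝ)⁻¹) * φ x y ^ (k + 2))
      (Real.exp (φ x y) - 1 - φ x y) := by
    have h2 := (hasSum_nat_add_iff' 2).2 hs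
    simp only [Finset.sum_range_succ, Finset.sum_range_zero, Nat.factorial_zero, Nat.cast_one,
      inv_one, pow_zero, zero_add, Nat.factorial_one, pow_one, smul_eq_mul, one_mul] at h2
    rwa [sub_sub]
  exact hs2.tendsto_sum_nat

/-- **Testing positive type on a finite type**: a symmetric kernel `φ` on a finite type `X` is
positive definite as soon as `∑_{x,y} c_x c_y φ(x,y) ≥ 0` for every FUNCTION `c : X → ℝ` — a
finite family `x : Fin n → X` with coefficients `c` aggregates to the function
`a ↦ ∑_{j : x j = a} c_j` with the same quadratic form (cf. `isNegDefKernel_of_sum_le`). [folklore] -/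
theorem _root_.Literature.Analysis.Matrix.isPosDefKernel_of_sum_nonneg {X : Type*} [Fintype X]
    [DecidableEq X] {φ : X → X → ℝ} (hsymm : ∀ x y, φ x y = φ y x)
    (h : ∀ c : X → ℝ, 0 ≤ ∑ x, ∑ y, c x * c y * φ x y) : IsPosDefKernel φ := by
  refine ⟨hsymm, fun n x c => ?_⟩
  -- aggregate the coefficients along the fibres of `x`
  set C : X → ℝ := fun a => ∑ j ∈ univ.filter (fun j => x j = a), c j with hC
  have hfib : ∀ (g : X → ℝ), ∑ j, c j * g (x j) = ∑ a, C a * g a := fun g => by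
    simp only [hC, Finset.sum_mul]
    rw [← Finset.sum_fiberwise_of_maps_to (s := univ) (t := univ) (g := x) (fun j _ => mem_univ _)]
    refine Finset.sum_congr rfl fun a _ => Finset.sum_congr rfl fun j hj => ?_
    rw [(Finset.mem_filter.1 hj).2]
  have hquad : ∑ j, ∑ k, c j * c k * φ (x j) (x k) = ∑ a, ∑ b, C a * C b * φ a b := by
    have h1 : ∀ j, ∑ k, c j * c k * φ (x j) (x k) = c j * ∑ b, C b * φ (x j) b := fun j => by
      have hf := hfib fun y => φ (x j) y
      rw [← hf, Finset.mul_sum]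
      exact Finset.sum_congr rfl fun k _ => by ring
    simp_rw [h1]
    have hf2 := hfib fun a => ∑ b, C b * φ a b
    rw [hf2]
    refine Finset.sum_congr rfl fun a _ => ?_
    rw [Finset.mul_sum]
    exact Finset.sum_congr rfl fun b _ => by ring
  rw [hquad]
  exact h C

end PosDef

/-! ### Characters: small real/imaginary-part facts -/

variable {d L : ℕ} [NeZero L]

namespace TorusLevyKhintchine

/-- `Re χ_k(-x) = Re χ_k(x)`. [folklore] -/
theorem re_torusChar_neg_right (k x : TorusSite d L) :
    (torusChar k (-x)).re = (torusChar k x).re := by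
  rw [torusChar_neg_right, Complex.conj_re]

/-- `Im χ_k(-x) = -Im χ_k(x)`. [folklore] -/
theorem im_torusChar_neg_right (k x : TorusSite d L) :
    (torusChar k (-x)).im = -(torusChar k x).im := by
  rw [torusChar_neg_right, Complex.conj_im]

/-- `Re χ_k(x) ≤ 1` (`‖χ_k(x)‖ = 1`). [folklore] -/
theorem re_torusChar_le_one (k x : TorusSite d L) : (torusChar k x).re ≤ 1 := by
  have h := Complex.re_le_norm (torusChar k x)
  rwa [norm_torusChar] at h

/-- The number of sites of the torus, as a real number: `∑_x 1 = L^d`. [folklore] -/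
theorem sum_one_eq_pow : ∑ _x : TorusSite d L, (1 : ℝ) = (L : ℝ) ^ d := by
  rw [Finset.sum_const, Finset.card_univ, nsmul_eq_mul, mul_one]
  have : Fintype.card (TorusSite d L) = L ^ d := by
    show Fintype.card (Fin d → ZMod L) = L ^ d
    rw [Fintype.card_fun, ZMod.card, Fintype.card_fin]
  rw [this]
  push_cast
  rfl

/-- **Orthogonality, real form**: `∑_x Re χ_k(x) = L^d` if `k = 0` and `0` otherwise. [folklore] -/
theorem sum_re_torusChar (k : TorusSite d L) :
    ∑ x, (torusChar k x).re = if k = 0 then (L : ℝ) ^ d else 0 := by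
  rw [← Complex.re_sum, sum_torusChar_right]
  split_ifs
  · rw [show ((L : ℂ) ^ d) = (((L : ℝ) ^ d : ℝ) : ℂ) by push_cast; rfl, Complex.ofReal_re]
  · rfl

/-- For an even real `f`, `∑_x f(x) Im χ_k(x) = 0` (pair `x` with `-x`). [folklore] -/
theorem sum_mul_im_torusChar_of_even (f : TorusSite d L → ℝ) (heven : ∀ x, f (-x) = f x)
    (k : TorusSite d L) : ∑ x, f x * (torusChar k x).im = 0 := by
  have h : ∑ x, f x * (torusChar k x).im = ∑ x, f (-x) * (torusChar k (-x)).im :=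
    (Equiv.sum_comp (Equiv.neg (TorusSite d L)) (fun x => f x * (torusChar k x).im)).symm
  simp only [heven, im_torusChar_neg_right, mul_neg, Finset.sum_neg_distrib] at h
  linarith

/-- The imaginary part of the Fourier coefficient of a real function:
`Im 𝓕f(k) = -∑_x f(x) Im χ_k(x)`. [folklore] -/
theorem torusFourier_ofReal_im_eq (f : TorusSite d L → ℝ) (k : TorusSite d L) :
    (torusFourier (fun x => (f x : ℂ)) k).im = -∑ x, f x * (torusChar k x).im := by
  rw [torusFourier_eq_sum_torusChar, Complex.im_sum, ← Finset.sum_neg_distrib]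
  refine Finset.sum_congr rfl fun x _ => ?_
  rw [Complex.im_ofReal_mul, Complex.conj_im, mul_neg]

end TorusLevyKhintchine

open TorusLevyKhintchine

/-! ### Cosine Fourier inversion and the finite-torus Lévy–Khintchine formula -/

/-- **Cosine Fourier inversion for even real functions on `(ℤ/Lℤ)^d`**:
`L^d · f(z) = ∑_q A(q) Re χ_q(z)` with `A(q) = ∑_x f(x) Re χ_q(x)` (the Fourier coefficients of an
even real function are real; `torusFourier_inversion`). Friedli–Velenik (2017) §10.4; Rudin (1962)
§1.4. [folklore] -/
theorem torus_real_inversion_of_even (f : TorusSite d L → ℝ) (heven : ∀ x, f (-x) = f x)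
    (z : TorusSite d L) :
    (L : ℝ) ^ d * f z = ∑ q, (∑ x, f x * (torusChar q x).re) * (torusChar q z).re := by
  set g : TorusSite d L → ℂ := torusFourier (fun x => (f x : ℂ)) with hg
  have hinv : (f z : ℂ) = torusFourierInv g z := by
    have := congrFun (torusFourier_inversion_holds (d := d) (L := L) (fun x => (f x : ℂ))) z
    rw [hg, this]
  rw [torusFourierInv_eq_sum_torusChar] at hinv
  have hL : ((L : ℂ) ^ d) * (f z : ℂ) = ∑ q, g q * torusChar q z := by
    rw [hinv, ← mul_assoc, mul_inv_cancel₀ natCast_pow_ne_zero, one_mul]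
  have hre := congrArg Complex.re hL
  rw [Complex.re_sum] at hre
  have hLre : (((L : ℂ) ^ d) * (f z : ℂ)).re = (L : ℝ) ^ d * f z := by
    rw [show ((L : ℂ) ^ d) = (((L : ℝ) ^ d : ℝ) : ℂ) by push_cast; rfl, ← Complex.ofReal_mul,
      Complex.ofReal_re]
  rw [hLre] at hre
  rw [hre]
  refine Finset.sum_congr rfl fun q _ => ?_
  have him : (g q).im = 0 := by
    rw [hg, torusFourier_ofReal_im_eq, sum_mul_im_torusChar_of_even f heven, neg_zero]
  rw [Complex.mul_re, him, zero_mul, sub_zero, hg, torusFourier_ofReal_re_eq]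

/-- **Lévy–Khintchine on the finite torus (pointwise form).** For an even real `f` on `(ℤ/Lℤ)^d`,
`L^d (f(0) - f(z)) = ∑_q A(q) (1 - Re χ_q(z))`, `A(q) = ∑_x f(x) Re χ_q(x)`; the `q = 0` term
vanishes. With `f = log k`, `φ = -log(k/k(0))` and `ν_q = A(q)/L^d` this is
`φ(z) = ∑_{q≠0} ν_q (1 - Re χ_q(z))`, the Lévy–Khintchine representation of a negative definite
function on the finite abelian group `(ℤ/Lℤ)^d` (all `ν_q ≥ 0` iff `φ` is negative definite,
`isNegDefKernel_neg_sub_iff_torusFourier_re_nonneg`). Berg–Christensen–Ressel (1984) Ch. 4 §3.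
[cite: BergChristensenRessel1984, Ch. 4 §3] -/
theorem levyKhintchine_pointwise (f : TorusSite d L → ℝ) (heven : ∀ x, f (-x) = f x)
    (z : TorusSite d L) :
    (L : ℝ) ^ d * (f 0 - f z) =
      ∑ q, (∑ x, f x * (torusChar q x).re) * (1 - (torusChar q z).re) := by
  have h0 := torus_real_inversion_of_even f heven 0
  have hz := torus_real_inversion_of_even f heven z
  simp only [torusChar_zero_right, Complex.one_re, mul_one] at h0
  rw [mul_sub, h0, hz, ← Finset.sum_sub_distrib]
  exact Finset.sum_congr rfl fun q _ => by ring

/-- **The Lévy mass is the mean of the log-decoherence.** For an even real `f` on `(ℤ/Lℤ)^d`,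
`∑_z (f(0) - f(z)) = ∑_{q ≠ 0} A(q)`; with `f = log k`: `L^{-d} ∑_z φ(z) = ∑_{q ≠ 0} ν_q =: |ν|`
(sum the pointwise formula over `z`; `∑_z Re χ_q(z) = L^d 𝟙{q = 0}`).
Berg–Christensen–Ressel (1984) Ch. 4 §3. [cite: BergChristensenRessel1984, Ch. 4 §3] -/
theorem levyKhintchine_mean (f : TorusSite d L → ℝ) (heven : ∀ x, f (-x) = f x) :
    ∑ z, (f 0 - f z) = ∑ q ∈ univ.erase 0, ∑ x, f x * (torusChar q x).re := by
  have hL : ((L : ℝ) ^ d) ≠ 0 := pow_ne_zero _ (Nat.cast_ne_zero.2 (NeZero.ne L))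
  apply mul_left_cancel₀ hL
  rw [Finset.mul_sum]
  simp_rw [levyKhintchine_pointwise f heven]
  rw [Finset.sum_comm]
  have hq : ∀ q : TorusSite d L,
      ∑ z, (∑ x, f x * (torusChar q x).re) * (1 - (torusChar q z).re) =
        (∑ x, f x * (torusChar q x).re) * ((L : ℝ) ^ d - if q = 0 then (L : ℝ) ^ d else 0) :=
    fun q => by
    rw [← Finset.mul_sum, Finset.sum_sub_distrib, sum_re_torusChar, sum_one_eq_pow]
  simp_rw [hq]
  rw [← Finset.add_sum_erase _ _ (mem_univ (0 : TorusSite d L)), if_pos rfl, sub_self, mul_zero,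
    zero_add, Finset.mul_sum]
  refine Finset.sum_congr rfl fun q hq' => ?_
  rw [if_neg (Finset.ne_of_mem_erase hq'), sub_zero, mul_comm]

/-! ### Bochner on the finite torus, positive-type form (⇐) -/

/-- **Bochner on the finite torus, positive-type form (⇐).** If `f : (ℤ/Lℤ)^d → ℝ` is even and
ALL its cosine coefficients are nonnegative, `0 ≤ ∑_x f(x) Re χ_q(x)` for every `q`, then
`(x, y) ↦ f(x - y)` is a positive definite kernel (`∑_{x,y} c_x c_y f(x-y) =
L^{-d} ∑_q Re 𝓕f(q) ‖𝓕c(q)‖² ≥ 0`). Rudin (1962) §1.4.3; Berg–Christensen–Ressel (1984) Ch. 4 §3.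
[folklore] -/
theorem isPosDefKernel_sub_of_torusFourier_re_nonneg (f : TorusSite d L → ℝ)
    (heven : ∀ x, f (-x) = f x)
    (hpos : ∀ q : TorusSite d L, 0 ≤ ∑ x, f x * (torusChar q x).re) :
    IsPosDefKernel fun x y : TorusSite d L => f (x - y) := by
  classical
  refine isPosDefKernel_of_sum_nonneg (fun x y => by rw [← heven (x - y), neg_sub]) fun c => ?_
  set g : TorusSite d L → ℂ := torusFourier (fun x => (f x : ℂ)) with hg
  have hinv : ∀ z, f z = (torusFourierInv g z).re := fun z => by
    have := congrFun (torusFourier_inversion_holds (d := d) (L := L) (fun x => (f x : ℂ))) z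
    rw [hg, this, Complex.ofReal_re]
  have hquad : ∑ x, ∑ y, c x * c y * f (x - y) =
      ((L : ℝ) ^ d)⁻¹ * ∑ k, (g k).re * ‖torusFourier (fun x => (c x : ℂ)) k‖ ^ 2 := by
    rw [← sum_sum_mul_torusFourierInv_re g c]
    simp only [hinv]
  rw [hquad]
  refine mul_nonneg (by positivity) (Finset.sum_nonneg fun k _ => ?_)
  rw [hg, torusFourier_ofReal_re_eq]
  exact mul_nonneg (hpos k) (by positivity)

/-! ### The Goldstone-wing bound -/

/-- **Goldstone-wing bound.** Let `k > 0` be even on `(ℤ/Lℤ)^d` with nonnegative Lévy coefficients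
`A(q) = ∑_x log k(x) Re χ_q(x) ≥ 0` for `q ≠ 0` (infinite divisibility of `k(x - y)`), and let
`|ν| = L^{-d} ∑_z (log k(0) - log k(z))` be its Lévy mass. Then for every `q ≠ 0`,
`A(q) ≤ (e^{|ν|} / k(0)) ∑_x k(x) Re χ_q(x)`, i.e. `ν_q ≤ e^{|ν|} k̂(q) / (L^d k(0))`: the Lévy
coefficient of a mode is at most `e^{|ν|}` times its (normalised) structure-factor weight. Proof:
`r = log k - log k(0) + |ν|` has all cosine coefficients `≥ 0` (the zero mode is
`∑ log k - L^d log k(0) + L^d |ν| = 0`), so `r(x-y)` is positive definite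
(`isPosDefKernel_sub_of_torusFourier_re_nonneg`), hence so is `exp r - 1 - r`
(`IsPosDefKernel.exp_sub_one_sub`), whose `q`-th coefficient `e^{|ν|} k̂(q)/k(0) - 0 - A(q)` is
therefore `≥ 0` (`torusFourier_re_nonneg_of_isNegDefKernel_neg_sub`).
Berg–Christensen–Ressel (1984) Ch. 3 §1–2, Ch. 4 §3. [cite: BergChristensenRessel1984, Ch. 3 Cor. 1.14 (PDF p. 71)] -/
theorem levy_wing_bound (k : TorusSite d L → ℝ) (hpos : ∀ x, 0 < k x)
    (heven : ∀ x, k (-x) = k x)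
    (hA : ∀ q : TorusSite d L, q ≠ 0 → 0 ≤ ∑ x, Real.log (k x) * (torusChar q x).re)
    (q : TorusSite d L) (hq : q ≠ 0) :
    ∑ x, Real.log (k x) * (torusChar q x).re ≤
      Real.exp ((∑ z, (Real.log (k 0) - Real.log (k z))) / (L : ℝ) ^ d) / k 0 *
        ∑ x, k x * (torusChar q x).re := by
  have hL0 : (0 : ℝ) < (L : ℝ) ^ d := pow_pos (Nat.cast_pos.2 (Nat.pos_of_ne_zero (NeZero.ne L))) d
  set N : ℝ := (L : ℝ) ^ d with hN
  set m : ℝ := (∑ z, (Real.log (k 0) - Real.log (k z))) / N with hm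
  set r : TorusSite d L → ℝ := fun x => Real.log (k x) - Real.log (k 0) + m with hr
  have hreven : ∀ x, r (-x) = r x := fun x => by simp only [hr, heven]
  -- the cosine coefficients of `r`
  have hexp : ∀ p : TorusSite d L, ∑ x, r x * (torusChar p x).re =
      ∑ x, Real.log (k x) * (torusChar p x).re +
        (m - Real.log (k 0)) * ∑ x, (torusChar p x).re := fun p => by
    rw [Finset.mul_sum, ← Finset.sum_add_distrib]
    exact Finset.sum_congr rfl fun x _ => by simp only [hr]; ring
  have hNm : N * m = ∑ z, (Real.log (k 0) - Real.log (k z)) := by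
    rw [hm, mul_div_cancel₀ _ hL0.ne']
  have hcoef : ∀ p : TorusSite d L, 0 ≤ ∑ x, r x * (torusChar p x).re := by
    intro p
    rw [hexp p, sum_re_torusChar]
    by_cases hp : p = 0
    · subst hp
      simp only [if_true, torusChar_zero_left, Complex.one_re, mul_one]
      rw [Finset.sum_sub_distrib, Finset.sum_const, Finset.card_univ, nsmul_eq_mul] at hNm
      have hc : (Fintype.card (TorusSite d L) : ℝ) = N := by
        rw [hN, ← sum_one_eq_pow, Finset.sum_const, Finset.card_univ, nsmul_eq_mul, mul_one]
      rw [hc] at hNm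
      nlinarith [hNm]
    · rw [if_neg hp, mul_zero, add_zero]
      exact hA p hp
  -- `r(x - y)` is positive definite, hence so is `exp r - 1 - r`, and `-(…)` is negative definite
  have hPD : IsPosDefKernel fun x y : TorusSite d L => r (x - y) :=
    isPosDefKernel_sub_of_torusFourier_re_nonneg r hreven hcoef
  have hND : IsNegDefKernel fun x y : TorusSite d L =>
      -(fun z => Real.exp (r z) - 1 - r z) (x - y) :=
    hPD.exp_sub_one_sub.isNegDefKernel_neg
  have h3 := torusFourier_re_nonneg_of_isNegDefKernel_neg_sub
    (fun z => Real.exp (r z) - 1 - r z) hND q hq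
  -- expand the coefficient of `exp r - 1 - r` at `q`
  have hsplit : ∑ x, (Real.exp (r x) - 1 - r x) * (torusChar q x).re =
      ∑ x, Real.exp (r x) * (torusChar q x).re - ∑ x, (torusChar q x).re -
        ∑ x, r x * (torusChar q x).re := by
    rw [← Finset.sum_sub_distrib, ← Finset.sum_sub_distrib]
    exact Finset.sum_congr rfl fun x _ => by ring
  have hone : ∑ x, (torusChar q x).re = 0 := by rw [sum_re_torusChar, if_neg hq]
  have hrq : ∑ x, r x * (torusChar q x).re = ∑ x, Real.log (k x) * (torusChar q x).re := by
    rw [hexp q, hone, mul_zero, add_zero]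
  have hexpr : ∀ x, Real.exp (r x) = Real.exp m / k 0 * k x := fun x => by
    simp only [hr]
    rw [Real.exp_add, Real.exp_sub, Real.exp_log (hpos x), Real.exp_log (hpos 0)]
    field_simp
  have hE : ∑ x, Real.exp (r x) * (torusChar q x).re =
      Real.exp m / k 0 * ∑ x, k x * (torusChar q x).re := by
    rw [Finset.mul_sum]
    exact Finset.sum_congr rfl fun x _ => by rw [hexpr x]; ring
  rw [hsplit, hone, sub_zero, hrq, hE] at h3
  linarith

/-! ### The UV-mass bound and the Lévy bootstrap lemma -/

/-- **UV-mass bound.** For an even real `f` on `(ℤ/Lℤ)^d` with nonnegative coefficients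
`A(q) = ∑_x f(x) Re χ_q(x) ≥ 0` at `q ≠ 0`, a set `S` of nonzero momenta, a set `D` of
displacements and a constant `c` with `∑_{z ∈ D} (1 - Re χ_q(z)) ≥ c` for every `q ∈ S`:
`c · ∑_{q ∈ S} A(q) ≤ L^d ∑_{z ∈ D} (f(0) - f(z))`. (With `f = log k`, `D = {e₁, e₂}`,
`S = {|q| ≥ κ}`: the Lévy mass carried by the ultraviolet modes is at most the nearest-neighbour
log-decoherence `(φ(e₁) + φ(e₂)) / c_κ`.) From `levyKhintchine_pointwise`, dropping the modes
outside `S`. [cite: BergChristensenRessel1984, Ch. 4 §3] -/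
theorem levy_uv_bound (f : TorusSite d L → ℝ) (heven : ∀ x, f (-x) = f x)
    (hA : ∀ q : TorusSite d L, q ≠ 0 → 0 ≤ ∑ x, f x * (torusChar q x).re)
    (S D : Finset (TorusSite d L)) (hS : ∀ q ∈ S, q ≠ 0) (c : ℝ)
    (hc : ∀ q ∈ S, c ≤ ∑ z ∈ D, (1 - (torusChar q z).re)) :
    c * ∑ q ∈ S, (∑ x, f x * (torusChar q x).re) ≤ (L : ℝ) ^ d * ∑ z ∈ D, (f 0 - f z) := by
  rw [Finset.mul_sum, Finset.mul_sum]
  simp_rw [levyKhintchine_pointwise f heven]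
  rw [Finset.sum_comm]
  have hterm : ∀ q : TorusSite d L, ∀ z : TorusSite d L,
      0 ≤ (∑ x, f x * (torusChar q x).re) * (1 - (torusChar q z).re) := by
    intro q z
    by_cases hq : q = 0
    · subst hq
      simp only [torusChar_zero_left, Complex.one_re, sub_self, mul_zero, le_refl]
    · exact mul_nonneg (hA q hq) (sub_nonneg.2 (re_torusChar_le_one q z))
  calc ∑ q ∈ S, c * ∑ x, f x * (torusChar q x).re
      ≤ ∑ q ∈ S, ∑ z ∈ D, (∑ x, f x * (torusChar q x).re) * (1 - (torusChar q z).re) := by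
        refine Finset.sum_le_sum fun q hq => ?_
        rw [← Finset.mul_sum, mul_comm]
        exact mul_le_mul_of_nonneg_left (hc q hq) (hA q (hS q hq))
    _ ≤ ∑ q, ∑ z ∈ D, (∑ x, f x * (torusChar q x).re) * (1 - (torusChar q z).re) :=
        Finset.sum_le_sum_of_subset_of_nonneg (Finset.subset_univ S)
          (fun q _ _ => Finset.sum_nonneg fun z _ => hterm q z)

/-- **The Lévy bootstrap lemma** (the deterministic engine of the log-bootstrap, layer P1 of crux
`LevyTransport` of route `HubbardSuperconductivity/LevyLogBootstrap`). Let `k > 0` be even on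
`(ℤ/Lℤ)^d` and infinitely divisible in Lévy form (`A(q) = ∑_x log k(x) Re χ_q(x) ≥ 0` for `q ≠ 0`),
with Lévy mass `|ν| = L^{-d} ∑_z (log k(0) - log k(z))`. For any set `S` of nonzero ("ultraviolet")
momenta, displacements `D` and `c > 0` with `∑_{z∈D} (1 - Re χ_q(z)) ≥ c` on `S`:
`|ν| ≤ U + β · e^{|ν|}` with the LOCAL term `U = (∑_{z∈D} (log k(0) - log k(z))) / c` and the
INFRARED WING `β = (∑_{q ∉ S, q ≠ 0} ∑_x k(x) Re χ_q(x)) / (L^d k(0))` — split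
`|ν| = ∑_{q∈S} ν_q + ∑_{q∉S, q≠0} ν_q` (`levyKhintchine_mean`), bound the first sum by
`levy_uv_bound` and the second termwise by `levy_wing_bound`. (Printed SHAPE of the move: Slade's
bootstrap lemma, LNM 1879 Lemma 5.9; here for the exponential bootstrap function of the route.)
[cite: BergChristensenRessel1984, Ch. 4 §3] -/
theorem levyMass_le_logBootstrap (k : TorusSite d L → ℝ) (hpos : ∀ x, 0 < k x)
    (heven : ∀ x, k (-x) = k x)
    (hA : ∀ q : TorusSite d L, q ≠ 0 → 0 ≤ ∑ x, Real.log (k x) * (torusChar q x).re)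
    (S D : Finset (TorusSite d L)) (hS : ∀ q ∈ S, q ≠ 0) {c : ℝ} (hc : 0 < c)
    (hcS : ∀ q ∈ S, c ≤ ∑ z ∈ D, (1 - (torusChar q z).re)) :
    (∑ z, (Real.log (k 0) - Real.log (k z))) / (L : ℝ) ^ d ≤
      (∑ z ∈ D, (Real.log (k 0) - Real.log (k z))) / c +
        (∑ q ∈ (univ.erase 0) \ S, ∑ x, k x * (torusChar q x).re) / ((L : ℝ) ^ d * k 0) *
          Real.exp ((∑ z, (Real.log (k 0) - Real.log (k z))) / (L : ℝ) ^ d) := by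
  have hL0 : (0 : ℝ) < (L : ℝ) ^ d := pow_pos (Nat.cast_pos.2 (Nat.pos_of_ne_zero (NeZero.ne L))) d
  have hk0 : 0 < k 0 := hpos 0
  set N : ℝ := (L : ℝ) ^ d with hN
  set m : ℝ := (∑ z, (Real.log (k 0) - Real.log (k z))) / N with hm
  set A : TorusSite d L → ℝ := fun q => ∑ x, Real.log (k x) * (torusChar q x).re with hAdef
  have hlogeven : ∀ x, Real.log (k (-x)) = Real.log (k x) := fun x => by rw [heven]
  -- Lévy mass identity and the split of the modes
  have hmean : N * m = ∑ q ∈ univ.erase 0, A q := by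
    rw [hm, mul_div_cancel₀ _ hL0.ne']
    exact levyKhintchine_mean (fun x => Real.log (k x)) hlogeven
  have hSsub : S ⊆ univ.erase 0 := fun q hq => Finset.mem_erase.2 ⟨hS q hq, mem_univ q⟩
  have hsplit : ∑ q ∈ univ.erase 0, A q = ∑ q ∈ S, A q + ∑ q ∈ (univ.erase 0) \ S, A q := by
    rw [← Finset.sum_sdiff hSsub, add_comm]
  -- the ultraviolet part
  have hUV : c * ∑ q ∈ S, A q ≤ N * ∑ z ∈ D, (Real.log (k 0) - Real.log (k z)) :=
    levy_uv_bound (fun x => Real.log (k x)) hlogeven hA S D hS c hcS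
  have hUV' : ∑ q ∈ S, A q ≤ N * ((∑ z ∈ D, (Real.log (k 0) - Real.log (k z))) / c) := by
    rw [mul_div_assoc', le_div_iff₀ hc, mul_comm]
    exact hUV
  -- the infrared part, mode by mode
  have hIR : ∑ q ∈ (univ.erase 0) \ S, A q ≤
      Real.exp m / k 0 * ∑ q ∈ (univ.erase 0) \ S, ∑ x, k x * (torusChar q x).re := by
    rw [Finset.mul_sum]
    refine Finset.sum_le_sum fun q hq => ?_
    have hq0 : q ≠ 0 := Finset.ne_of_mem_erase (Finset.mem_sdiff.1 hq).1
    exact levy_wing_bound k hpos heven hA q hq0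
  -- assemble and divide by `N`
  have htot : N * m ≤ N * ((∑ z ∈ D, (Real.log (k 0) - Real.log (k z))) / c) +
      Real.exp m / k 0 * ∑ q ∈ (univ.erase 0) \ S, ∑ x, k x * (torusChar q x).re := by
    rw [hmean, hsplit]
    exact add_le_add hUV' hIR
  have hdiv : m ≤ (∑ z ∈ D, (Real.log (k 0) - Real.log (k z))) / c +
      (Real.exp m / k 0 * ∑ q ∈ (univ.erase 0) \ S, ∑ x, k x * (torusChar q x).re) / N := by
    have h3 := div_le_div_of_nonneg_right htot hL0.le
    rw [mul_div_cancel_left₀ _ hL0.ne', add_div, mul_div_cancel_left₀ _ hL0.ne'] at h3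
    exact h3
  calc m ≤ _ := hdiv
    _ = (∑ z ∈ D, (Real.log (k 0) - Real.log (k z))) / c +
        (∑ q ∈ (univ.erase 0) \ S, ∑ x, k x * (torusChar q x).re) / (N * k 0) * Real.exp m := by
        congr 1
        field_simp

end Literature.Probability.LatticeModels

end
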